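import Summits.Ventures.PercRepro.GenQBalance

/-!
# PercRepro — the balance `Jq` at EVERY type `t` as a counting identity (night-2, gen 4; RULING (rs)(1)(a))

For a rank-`q` set `G` the landed balance at `(q + 2, q)` and type `t` is
`Jq M G q t = Σ_{S ∈ R_q(G)} (q + 2 − t)·w_∞(S) − Φ·(N_q − DF_t)`, `w_∞(S) = 1/(1 + m(S))`, `Φ = (q + 2)/(q + 1)`
(`GenQBalance`).  Multiplying by `q + 1` and paying `Φ·N_q` set by set gives the exact identity
**`(q + 1)·J_t = (q + 2)·DF_t + Σ_{S ∈ R_q(G)} f_{q,t}(m(S))`, `f_{q,t}(m) = (q + 1)(q + 2 − t)/(1 + m) − (q + 2)`**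
(`Jq_mul_succ_eq`, with `w_∞` written out in `Jq_mul_succ_eq_mTr`).  The type-`3` case is the identity of
`NIGHT-2-profile.md` §1 (`f_{q,3}(m) = (q² − 1)/(1 + m) − (q + 2)`); the type-`4` case (`Jq_four_mul_succ_eq`) has
`f_{q,4}(m) = (q + 1)(q − 2)/(1 + m) − (q + 2)` — at `q = 5`: `18/(1 + m) − 7`, i.e. `−4` on a basis, `−5/2` at
`m = 3`, `−1` at `m = 2`, `2` at `m = 1`, `11` on a coloop-free spanning set; the type-`2` case
(`Jq_two_mul_succ_eq`) has `f_{q,2}(m) = q(q + 1)/(1 + m) − (q + 2)` — at `q = 5`: `30/(1 + m) − 7`.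
Nothing is assumed about `M`: the identity is a rearrangement of the definition.  Imports `GenQBalance` only.
-/
namespace PercRepro.Star

open Finset ThmH SixFour GenQ

variable {α : Type*} [DecidableEq α] {M : Matroid α} [M.Finite]

/-- **The balance at type `t`, multiplied by `q + 1`, as a counting identity**:
`(q + 1)·J_t = (q + 2)·DF_t + Σ_{S ∈ R_q(G)} ((q + 1)(q + 2 − t)·w_∞(S) − (q + 2))`. -/
theorem Jq_mul_succ_eq (G : Finset α) (q t : ℕ) :
    ((q : ℚ) + 1) * Jq M G q t =
      ((q : ℚ) + 2) * (DFq M G q t : ℚ) +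
        ∑ S ∈ Rq M G q, (((q : ℚ) + 1) * ((q : ℚ) + 2 - t) * wInf M S - ((q : ℚ) + 2)) := by
  unfold Jq Nq
  have hpos : (0 : ℚ) < (q : ℚ) + 1 := by positivity
  have h1 : ((q : ℚ) + 1) * ((((q : ℚ) + 2) / ((q : ℚ) + 1)) * (((Rq M G q).card : ℚ) - (DFq M G q t : ℚ))) =
      ((q : ℚ) + 2) * (((Rq M G q).card : ℚ) - (DFq M G q t : ℚ)) := by
    field_simp
  rw [Finset.sum_sub_distrib, Finset.sum_const, nsmul_eq_mul, mul_sub, h1, Finset.mul_sum]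
  have h2 : ∑ S ∈ Rq M G q, ((q : ℚ) + 1) * (((q : ℚ) + 2 - t) * wInf M S) =
      ∑ S ∈ Rq M G q, ((q : ℚ) + 1) * ((q : ℚ) + 2 - t) * wInf M S := by
    apply Finset.sum_congr rfl
    intro S _
    ring
  rw [h2]
  ring

/-- The same identity with the per-set income written through the coloop count:
`f_{q,t}(m(S)) = (q + 1)(q + 2 − t)/(1 + m(S)) − (q + 2)`. -/
theorem Jq_mul_succ_eq_mTr (G : Finset α) (q t : ℕ) :
    ((q : ℚ) + 1) * Jq M G q t =
      ((q : ℚ) + 2) * (DFq M G q t : ℚ) +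
        ∑ S ∈ Rq M G q, (((q : ℚ) + 1) * ((q : ℚ) + 2 - t) / (1 + (mTr M S : ℚ)) - ((q : ℚ) + 2)) := by
  rw [Jq_mul_succ_eq]
  congr 1
  apply Finset.sum_congr rfl
  intro S _
  unfold wInf
  ring

/-- **The type-`4` identity** (RULING (rs)(1)(a)):
`(q + 1)·J_4 = (q + 2)·DF_4 + Σ_{S ∈ R_q(G)} ((q + 1)(q − 2)/(1 + m(S)) − (q + 2))`. -/
theorem Jq_four_mul_succ_eq (G : Finset α) (q : ℕ) :
    ((q : ℚ) + 1) * Jq M G q 4 =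
      ((q : ℚ) + 2) * (DFq M G q 4 : ℚ) +
        ∑ S ∈ Rq M G q, (((q : ℚ) + 1) * ((q : ℚ) - 2) / (1 + (mTr M S : ℚ)) - ((q : ℚ) + 2)) := by
  rw [Jq_mul_succ_eq_mTr]
  congr 1
  apply Finset.sum_congr rfl
  intro S _
  push_cast
  ring

/-- **The type-`2` identity**:
`(q + 1)·J_2 = (q + 2)·DF_2 + Σ_{S ∈ R_q(G)} (q(q + 1)/(1 + m(S)) − (q + 2))`. -/
theorem Jq_two_mul_succ_eq (G : Finset α) (q : ℕ) :
    ((q : ℚ) + 1) * Jq M G q 2 =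
      ((q : ℚ) + 2) * (DFq M G q 2 : ℚ) +
        ∑ S ∈ Rq M G q, ((q : ℚ) * ((q : ℚ) + 1) / (1 + (mTr M S : ℚ)) - ((q : ℚ) + 2)) := by
  rw [Jq_mul_succ_eq_mTr]
  congr 1
  apply Finset.sum_congr rfl
  intro S _
  push_cast
  ring

/-- **The type-`3` identity** in the same form (the identity of `NIGHT-2-profile.md` §1):
`(q + 1)·J_3 = (q + 2)·DF_3 + Σ_{S ∈ R_q(G)} ((q² − 1)/(1 + m(S)) − (q + 2))`. -/
theorem Jq_three_mul_succ_eq' (G : Finset α) (q : ℕ) :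
    ((q : ℚ) + 1) * Jq M G q 3 =
      ((q : ℚ) + 2) * (DFq M G q 3 : ℚ) +
        ∑ S ∈ Rq M G q, (((q : ℚ) ^ 2 - 1) / (1 + (mTr M S : ℚ)) - ((q : ℚ) + 2)) := by
  rw [Jq_mul_succ_eq_mTr]
  congr 1
  apply Finset.sum_congr rfl
  intro S _
  push_cast
  ring

/-- At `q = 5` the type-`4` income of a set with `m` coloops is `18/(1 + m) − 7`. -/
theorem Jq_five_four_mul_six_eq (G : Finset α) :
    (6 : ℚ) * Jq M G 5 4 =
      7 * (DFq M G 5 4 : ℚ) + ∑ S ∈ Rq M G 5, (18 / (1 + (mTr M S : ℚ)) - 7) := by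
  have h := Jq_four_mul_succ_eq (M := M) G 5
  have h6 : ((5 : ℕ) : ℚ) + 1 = 6 := by norm_num
  have h7 : ((5 : ℕ) : ℚ) + 2 = 7 := by norm_num
  rw [h6, h7] at h
  rw [h]
  congr 1
  apply Finset.sum_congr rfl
  intro S _
  norm_num

/-- At `q = 5` the type-`2` income of a set with `m` coloops is `30/(1 + m) − 7`. -/
theorem Jq_five_two_mul_six_eq (G : Finset α) :
    (6 : ℚ) * Jq M G 5 2 =
      7 * (DFq M G 5 2 : ℚ) + ∑ S ∈ Rq M G 5, (30 / (1 + (mTr M S : ℚ)) - 7) := by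
  have h := Jq_two_mul_succ_eq (M := M) G 5
  have h6 : ((5 : ℕ) : ℚ) + 1 = 6 := by norm_num
  have h7 : ((5 : ℕ) : ℚ) + 2 = 7 := by norm_num
  rw [h6, h7] at h
  rw [h]
  congr 1
  apply Finset.sum_congr rfl
  intro S _
  norm_num

end PercRepro.Star
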